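import Summits.Ventures.HodgeRepro.TwistedQuadSegAll

/-!
# Theorem S, `M` form: the residue-class arithmetic of the 8-periodic family

Blind re-derivation cell `pub-hodge-repro`, seat `p1` (gen 12).  The coset pattern `f₁(n) = [(n − j + 1) mod 8 < 4]`
of the `M`-form family (`seg1M`) and the SumTwo counts of `TwistedQuadSegAllM` as pure statements about natural
numbers: for every `j ≡ 2 (mod 4)` and every position `x` of a point on `⟨v⟩` (`a = 0, 1`, `2 ≤ a < 3j + 1`,
`3j + 1 ≤ a < 4j`) resp. on the `u`-coset (`a = 0, 1`, `2 ≤ a ≤ j`, `j < a ≤ 2j`, `2j < a < 4j`), exactly two of the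
four neighbours satisfy the pattern (`seg0` = `TwistedQuadSegAll`'s `[n mod 8 ∈ {2, 4, 5, 7}]`).  Each lemma is a
case split on `x mod 8` (and `j mod 8 ∈ {2, 6}`) closed by `omega`; they are separate declarations only to keep each
within the default heartbeat budget.
-/

set_option autoImplicit false

namespace HodgeRepro.TwistedQuadGen

variable (j : ℕ) [NeZero j]

/-- `f₁(n) = [(n − j + 1) mod 8 < 4]`, written without natural subtraction. -/
def seg1M (n : ℕ) : Prop := (n + 9 - j % 8) % 8 < 4

omit [NeZero j] in
/-- The predicate `seg1M j` is decidable. -/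
instance : DecidablePred (seg1M j) := fun n => by unfold seg1M; infer_instance

omit [NeZero j] in
/-- The `⟨v⟩`-layer count at `a = 0`. -/
theorem segM_sum_zero_0 (hj : j % 4 = 2) :
    ((if seg0 0 then 1 else 0) + (if seg0 (0 + (4 * j - 1)) then 1 else 0) +
      (if seg0 (0 + (4 * j - 2)) then 1 else 0) + (if seg1M j (0 + (j - 1)) then 1 else 0) : ℕ) = 2 := by
  unfold seg0 seg1M
  rw [if_neg (by omega), if_pos (by omega), if_neg (by omega), if_pos (by omega)]

omit [NeZero j] in
/-- The `⟨v⟩`-layer count at `a = 1`. -/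
theorem segM_sum_zero_1 (hj : j % 4 = 2) :
    ((if seg0 1 then 1 else 0) + (if seg0 (1 + (4 * j - 1) - 4 * j) then 1 else 0) +
      (if seg0 (1 + (4 * j - 2)) then 1 else 0) + (if seg1M j (1 + (j - 1)) then 1 else 0) : ℕ) = 2 := by
  unfold seg0 seg1M
  rw [if_neg (by omega), if_neg (by omega), if_pos (by omega), if_pos (by omega)]

omit [NeZero j] in
/-- The `⟨v⟩`-layer count for `2 ≤ a.val < 3j + 1`. -/
theorem segM_sum_zero_mid (hj : j % 4 = 2) (x : ℕ) (hx : 2 ≤ x) (_hx' : x < 3 * j + 1) :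
    ((if seg0 x then 1 else 0) + (if seg0 (x - 1) then 1 else 0) + (if seg0 (x - 2) then 1 else 0) +
      (if seg1M j (x + (j - 1)) then 1 else 0) : ℕ) = 2 := by
  unfold seg0 seg1M
  obtain ⟨r, hr8, hxr⟩ : ∃ r, r < 8 ∧ x % 8 = r := ⟨x % 8, Nat.mod_lt _ (by norm_num), rfl⟩
  interval_cases r <;> split_ifs <;> omega

omit [NeZero j] in
/-- The `⟨v⟩`-layer count for `3j + 1 ≤ a.val < 4j`, `j ≡ 2 (mod 8)`. -/
theorem segM_sum_zero_hi2 (hj8 : j % 8 = 2) (x : ℕ) (hx : 3 * j + 1 ≤ x) (hx' : x < 4 * j) :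
    ((if seg0 x then 1 else 0) + (if seg0 (x - 1) then 1 else 0) + (if seg0 (x - 2) then 1 else 0) +
      (if seg1M j (x + (j - 1) - 4 * j) then 1 else 0) : ℕ) = 2 := by
  unfold seg0 seg1M
  obtain ⟨r, hr8, hxr⟩ : ∃ r, r < 8 ∧ x % 8 = r := ⟨x % 8, Nat.mod_lt _ (by norm_num), rfl⟩
  interval_cases r <;> split_ifs <;> omega

omit [NeZero j] in
/-- The `⟨v⟩`-layer count for `3j + 1 ≤ a.val < 4j`, `j ≡ 6 (mod 8)`. -/
theorem segM_sum_zero_hi6 (hj8 : j % 8 = 6) (x : ℕ) (hx : 3 * j + 1 ≤ x) (hx' : x < 4 * j) :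
    ((if seg0 x then 1 else 0) + (if seg0 (x - 1) then 1 else 0) + (if seg0 (x - 2) then 1 else 0) +
      (if seg1M j (x + (j - 1) - 4 * j) then 1 else 0) : ℕ) = 2 := by
  unfold seg0 seg1M
  obtain ⟨r, hr8, hxr⟩ : ∃ r, r < 8 ∧ x % 8 = r := ⟨x % 8, Nat.mod_lt _ (by norm_num), rfl⟩
  interval_cases r <;> split_ifs <;> omega

omit [NeZero j] in
/-- The `⟨v⟩`-layer count for `3j + 1 ≤ a.val < 4j` (the last neighbour wraps around). -/
theorem segM_sum_zero_hi (hj : j % 4 = 2) (x : ℕ) (hx : 3 * j + 1 ≤ x) (hx' : x < 4 * j) :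
    ((if seg0 x then 1 else 0) + (if seg0 (x - 1) then 1 else 0) + (if seg0 (x - 2) then 1 else 0) +
      (if seg1M j (x + (j - 1) - 4 * j) then 1 else 0) : ℕ) = 2 := by
  rcases (show j % 8 = 2 ∨ j % 8 = 6 by omega) with h | h
  · exact segM_sum_zero_hi2 j h x hx hx'
  · exact segM_sum_zero_hi6 j h x hx hx'

omit [NeZero j] in
/-- The `u`-coset count at `a = 0`. -/
theorem segM_sum_one_0 (hj : j % 4 = 2) :
    ((if seg1M j 0 then 1 else 0) + (if seg1M j (0 + (2 * j - 1)) then 1 else 0) +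
      (if seg1M j (0 + (4 * j - 2)) then 1 else 0) + (if seg0 (0 + (3 * j - 1)) then 1 else 0) : ℕ) = 2 := by
  unfold seg0 seg1M
  rcases (show j % 8 = 2 ∨ j % 8 = 6 by omega) with h | h <;> split_ifs <;> omega

omit [NeZero j] in
/-- The `u`-coset count at `a = 1`. -/
theorem segM_sum_one_1 (hj : j % 4 = 2) :
    ((if seg1M j 1 then 1 else 0) + (if seg1M j (1 + (2 * j - 1)) then 1 else 0) +
      (if seg1M j (1 + (4 * j - 2)) then 1 else 0) + (if seg0 (1 + (3 * j - 1)) then 1 else 0) : ℕ) = 2 := by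
  unfold seg0 seg1M
  rcases (show j % 8 = 2 ∨ j % 8 = 6 by omega) with h | h <;> split_ifs <;> omega

omit [NeZero j] in
/-- `segM_sum_one_B` for `j ≡ 2 (mod 8)`. -/
theorem segM_sum_one_B2 (hj8 : j % 8 = 2) (x : ℕ) (hx : 2 ≤ x) (_hx' : x ≤ j) :
    ((if seg1M j x then 1 else 0) + (if seg1M j (x + (2 * j - 1)) then 1 else 0) +
      (if seg1M j (x - 2) then 1 else 0) + (if seg0 (x + (3 * j - 1)) then 1 else 0) : ℕ) = 2 := by
  unfold seg0 seg1M
  simp only [hj8]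
  obtain ⟨r, hr8, hxr⟩ : ∃ r, r < 8 ∧ x % 8 = r := ⟨x % 8, Nat.mod_lt _ (by norm_num), rfl⟩
  interval_cases r <;> split_ifs <;> omega

omit [NeZero j] in
/-- `segM_sum_one_B` for `j ≡ 6 (mod 8)`. -/
theorem segM_sum_one_B6 (hj8 : j % 8 = 6) (x : ℕ) (hx : 2 ≤ x) (_hx' : x ≤ j) :
    ((if seg1M j x then 1 else 0) + (if seg1M j (x + (2 * j - 1)) then 1 else 0) +
      (if seg1M j (x - 2) then 1 else 0) + (if seg0 (x + (3 * j - 1)) then 1 else 0) : ℕ) = 2 := by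
  unfold seg0 seg1M
  simp only [hj8]
  obtain ⟨r, hr8, hxr⟩ : ∃ r, r < 8 ∧ x % 8 = r := ⟨x % 8, Nat.mod_lt _ (by norm_num), rfl⟩
  interval_cases r <;> split_ifs <;> omega

omit [NeZero j] in
/-- The `u`-coset count, case `B`. -/
theorem segM_sum_one_B (hj : j % 4 = 2) (x : ℕ) (hx : 2 ≤ x) (hx' : x ≤ j) :
    ((if seg1M j x then 1 else 0) + (if seg1M j (x + (2 * j - 1)) then 1 else 0) +
      (if seg1M j (x - 2) then 1 else 0) + (if seg0 (x + (3 * j - 1)) then 1 else 0) : ℕ) = 2 := by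
  rcases (show j % 8 = 2 ∨ j % 8 = 6 by omega) with h | h
  · exact segM_sum_one_B2 j h x hx hx'
  · exact segM_sum_one_B6 j h x hx hx'

omit [NeZero j] in
/-- `segM_sum_one_C` for `j ≡ 2 (mod 8)`. -/
theorem segM_sum_one_C2 (hj8 : j % 8 = 2) (x : ℕ) (hx : j < x) (hx' : x ≤ 2 * j) :
    ((if seg1M j x then 1 else 0) + (if seg1M j (x + (2 * j - 1)) then 1 else 0) +
      (if seg1M j (x - 2) then 1 else 0) + (if seg0 (x + (3 * j - 1) - 4 * j) then 1 else 0) : ℕ) = 2 := by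
  unfold seg0 seg1M
  simp only [hj8]
  obtain ⟨r, hr8, hxr⟩ : ∃ r, r < 8 ∧ x % 8 = r := ⟨x % 8, Nat.mod_lt _ (by norm_num), rfl⟩
  interval_cases r <;> split_ifs <;> omega

omit [NeZero j] in
/-- `segM_sum_one_C` for `j ≡ 6 (mod 8)`. -/
theorem segM_sum_one_C6 (hj8 : j % 8 = 6) (x : ℕ) (hx : j < x) (hx' : x ≤ 2 * j) :
    ((if seg1M j x then 1 else 0) + (if seg1M j (x + (2 * j - 1)) then 1 else 0) +
      (if seg1M j (x - 2) then 1 else 0) + (if seg0 (x + (3 * j - 1) - 4 * j) then 1 else 0) : ℕ) = 2 := by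
  unfold seg0 seg1M
  simp only [hj8]
  obtain ⟨r, hr8, hxr⟩ : ∃ r, r < 8 ∧ x % 8 = r := ⟨x % 8, Nat.mod_lt _ (by norm_num), rfl⟩
  interval_cases r <;> split_ifs <;> omega

omit [NeZero j] in
/-- The `u`-coset count, case `C`. -/
theorem segM_sum_one_C (hj : j % 4 = 2) (x : ℕ) (hx : j < x) (hx' : x ≤ 2 * j) :
    ((if seg1M j x then 1 else 0) + (if seg1M j (x + (2 * j - 1)) then 1 else 0) +
      (if seg1M j (x - 2) then 1 else 0) + (if seg0 (x + (3 * j - 1) - 4 * j) then 1 else 0) : ℕ) = 2 := by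
  rcases (show j % 8 = 2 ∨ j % 8 = 6 by omega) with h | h
  · exact segM_sum_one_C2 j h x hx hx'
  · exact segM_sum_one_C6 j h x hx hx'

omit [NeZero j] in
/-- `segM_sum_one_D` for `j ≡ 2 (mod 8)`. -/
theorem segM_sum_one_D2 (hj8 : j % 8 = 2) (x : ℕ) (hx : 2 * j < x) (hx' : x < 4 * j) :
    ((if seg1M j x then 1 else 0) + (if seg1M j (x + (2 * j - 1) - 4 * j) then 1 else 0) +
      (if seg1M j (x - 2) then 1 else 0) + (if seg0 (x + (3 * j - 1) - 4 * j) then 1 else 0) : ℕ) = 2 := by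
  unfold seg0 seg1M
  simp only [hj8]
  obtain ⟨r, hr8, hxr⟩ : ∃ r, r < 8 ∧ x % 8 = r := ⟨x % 8, Nat.mod_lt _ (by norm_num), rfl⟩
  interval_cases r <;> split_ifs <;> omega

omit [NeZero j] in
/-- `segM_sum_one_D` for `j ≡ 6 (mod 8)`. -/
theorem segM_sum_one_D6 (hj8 : j % 8 = 6) (x : ℕ) (hx : 2 * j < x) (hx' : x < 4 * j) :
    ((if seg1M j x then 1 else 0) + (if seg1M j (x + (2 * j - 1) - 4 * j) then 1 else 0) +
      (if seg1M j (x - 2) then 1 else 0) + (if seg0 (x + (3 * j - 1) - 4 * j) then 1 else 0) : ℕ) = 2 := by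
  unfold seg0 seg1M
  simp only [hj8]
  obtain ⟨r, hr8, hxr⟩ : ∃ r, r < 8 ∧ x % 8 = r := ⟨x % 8, Nat.mod_lt _ (by norm_num), rfl⟩
  interval_cases r <;> split_ifs <;> omega

omit [NeZero j] in
/-- The `u`-coset count, case `D`. -/
theorem segM_sum_one_D (hj : j % 4 = 2) (x : ℕ) (hx : 2 * j < x) (hx' : x < 4 * j) :
    ((if seg1M j x then 1 else 0) + (if seg1M j (x + (2 * j - 1) - 4 * j) then 1 else 0) +
      (if seg1M j (x - 2) then 1 else 0) + (if seg0 (x + (3 * j - 1) - 4 * j) then 1 else 0) : ℕ) = 2 := by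
  rcases (show j % 8 = 2 ∨ j % 8 = 6 by omega) with h | h
  · exact segM_sum_one_D2 j h x hx hx'
  · exact segM_sum_one_D6 j h x hx hx'

end HodgeRepro.TwistedQuadGen
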